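import Literature.Probability.RandomPlanarGeometry.SLEKappaRhoLambda
import Literature.Probability.RandomPlanarGeometry.StarHullCanonical
import HarnessLib

/-!
# The drift function `D = d²/E_B − E_B'/z` of [LSW] (5.1) as one holomorphic function on the box

G. F. Lawler, O. Schramm, W. Werner, *Conformal restriction: the chordal case*, J. Amer. Math.
Soc. **16** (2003), §5 (5.1): `∂_t h_t(z) = 2h_t'(W_t)²/(h_t(z) − h_t(W_t)) − 2h_t'(z)/(z − W_t)`.
In slid coordinates the right-hand side is `2 D(z − W_t)`, `D(z) = d²/E_B(z) − E_B'(z)/z`, a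
function with a removable singularity at the tip `z = 0` where `D(0) = −(3/2)E_B''(0)`
(`Loewner.driftFun`, `starDrift`, `LoewnerImageStepJet`: the holomorphic extension near the tip is
given by a Cauchy integral over `|ζ| = ρ₀/2`).

For the expansion of the one-sided martingale (force point `O_t` far from the tip AND the tip
itself) one needs `D` as a SINGLE holomorphic function on the box `jetBox R η` of
`SLEKappaRhoLogGamma`. This file glues the two descriptions:

* `glueDrift B ρ₀ z` — `starDrift B ρ₀ z` for `|z| < ρ₀/4`, the formula `d²/E_B(z) − E_B'(z)/z`
  otherwise; equal to the formula at every `z ≠ 0` of the box (`glueDrift_eq_of_ne_zero`);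
* `differentiableOn_glueDrift`, `norm_glueDrift_le`, `driftData_glueDrift` — it is holomorphic on
  the box with `|D| ≤ 32/ρ₀ + 4/(δρ₀)` (near the tip `≤ 24/ρ₀`, `Loewner.norm_driftFun_le`; away,
  `|E_B(z)| ≥ δ|z|`), i.e. it is a `DriftData` for the box;
* `glueDrift_zero`, `deriv_glueDrift_zero`, `deriv_glueDrift_of_ne_zero` — the jet at the tip
  (`D(0) = −(3/2)E''(0)`, `D'(0) = E''(0)²/(4d) − (2/3)E'''(0)`, Lawler's (4.35)/(4.37)) and the
  derivative of the formula off the tip, so that `lam_zero_eq_jetLam` applies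
  (`lam_glueDrift_zero_eq_jetLam`).

No named facts; one definition.

## References

* [LSW] §5 (5.1)–(5.2); §8.4 proof of Lemma 8.9. [LawlerSchrammWerner2003Restriction]
* G. F. Lawler, *Conformally Invariant Processes in the Plane* (2005), §4.6.1 (4.35)–(4.37). [Lawler2005]
-/

noncomputable section

open Set Filter Metric Complex
open scoped Topology Real

namespace Literature.Probability.RandomPlanarGeometry

namespace SLEKappaRho

variable {B : Set ℂ} {ρ₀ δ η R : ℝ}

open Classical in
/-- **The glued drift function**: `starDrift B ρ₀` on `|z| < ρ₀/4`, `d²/E_B(z) − E_B'(z)/z`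
otherwise (`d = starDeriv B`, `E_B = starMap B`). [cite: LawlerSchrammWerner2003Restriction, §5 (5.1)] -/
def glueDrift (B : Set ℂ) (ρ₀ : ℝ) (z : ℂ) : ℂ :=
  if ‖z‖ < ρ₀ / 4 then starDrift B ρ₀ z
  else (starDeriv B : ℂ) ^ 2 / starMap B z - deriv (starMap B) z / z

section Glue

variable (hB : IsStarHull B) (hρ₀ : 0 < ρ₀) (hBρ : Disjoint (ball (0 : ℂ) (8 * ρ₀)) B)
include hB hρ₀ hBρ

/-- **`glueDrift = d²/E − E'/z` at every `z ≠ 0` with `|z| < ρ₀/2` or `|z| ≥ ρ₀/4`** — i.e. at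
every `z ≠ 0` (the two descriptions agree on the annulus). [cite: LawlerSchrammWerner2003Restriction, §5 (5.1)] -/
theorem glueDrift_eq_of_ne_zero {z : ℂ} (hz0 : z ≠ 0) :
    glueDrift B ρ₀ z = (starDeriv B : ℂ) ^ 2 / starMap B z - deriv (starMap B) z / z := by
  unfold glueDrift
  split_ifs with h
  · rw [starDrift_eq hB, starMap_eq hB]
    exact Loewner.driftFun_eq_of_ne_zero hB (isRestrictionMap_starRMap hB) (starDeriv_spec hB).2.2 hρ₀ hBρ
      (mem_ball_zero_iff.2 (by linarith)) hz0
  · rfl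

omit hB hρ₀ hBρ in
/-- Near the tip `glueDrift = starDrift` (by definition). [folklore] -/
theorem glueDrift_eq_starDrift {z : ℂ} (hz : ‖z‖ < ρ₀ / 4) : glueDrift B ρ₀ z = starDrift B ρ₀ z := by
  unfold glueDrift; rw [if_pos hz]

omit hB hρ₀ hBρ in
/-- `glueDrift =ᶠ starDrift` near every point of the small disc. [folklore] -/
theorem glueDrift_eventuallyEq_starDrift {z : ℂ} (hz : ‖z‖ < ρ₀ / 4) :
    glueDrift B ρ₀ =ᶠ[𝓝 z] starDrift B ρ₀ := by
  have hopen : IsOpen {w : ℂ | ‖w‖ < ρ₀ / 4} := isOpen_lt continuous_norm continuous_const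
  filter_upwards [hopen.mem_nhds hz] with w hw using glueDrift_eq_starDrift hw

/-- **`D(0) = −(3/2) E_B''(0)`** (Lawler (4.35)). [cite: Lawler2005, §4.6.1 (4.35)] -/
theorem glueDrift_zero : glueDrift B ρ₀ 0 = -(3 / 2 : ℂ) * deriv (deriv (starMap B)) 0 := by
  rw [glueDrift_eq_starDrift (B := B) (by rw [norm_zero]; positivity), starDrift_eq hB, starMap_eq hB]
  exact Loewner.driftFun_zero hB (isRestrictionMap_starRMap hB) (starDeriv_spec hB).2.2 hρ₀ hBρ

/-- **`D'(0) = E_B''(0)²/(4d) − (2/3)E_B'''(0)`** (Lawler (4.37)). [cite: Lawler2005, §4.6.1 (4.37)] -/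
theorem deriv_glueDrift_zero :
    deriv (glueDrift B ρ₀) 0 = (deriv (deriv (starMap B)) 0) ^ 2 / (4 * (starDeriv B : ℂ)) -
      (2 / 3 : ℂ) * deriv (deriv (deriv (starMap B))) 0 := by
  rw [(glueDrift_eventuallyEq_starDrift (B := B) (z := 0) (by rw [norm_zero]; positivity)).deriv_eq,
    starDrift_eq hB, starMap_eq hB]
  exact (Loewner.hasDerivAt_driftFun_zero hB (isRestrictionMap_starRMap hB) (starDeriv_spec hB).2.2 hρ₀ hBρ).deriv

end Glue

section Box

variable (hB : IsStarHull B) (hρ₀ : 0 < ρ₀) (hBρ : Disjoint (ball (0 : ℂ) (8 * ρ₀)) B)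
  (hJ : JetControl (starMap B) δ η R)
include hB hρ₀ hBρ hJ

omit hB hρ₀ hBρ in
/-- `|E_B(z)| ≥ δ|z|` on the box (`E z = z · DQ E z 0`, `Re DQ ≥ δ`). [folklore] -/
theorem norm_starMap_ge {z : ℂ} (hz : z ∈ jetBox R η) : δ * ‖z‖ ≤ ‖starMap B z‖ := by
  have h := DQ_mul_sub (starMap B) z 0
  rw [hJ.map_zero, sub_zero, sub_zero] at h
  have hDQ : δ ≤ ‖DQ (starMap B) z 0‖ := (le_re_DQ_and_norm_DQ_le hJ hz hJ.zero_mem).1.trans (re_le_norm _)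
  calc δ * ‖z‖ ≤ ‖DQ (starMap B) z 0‖ * ‖z‖ := mul_le_mul_of_nonneg_right hDQ (norm_nonneg z)
    _ = ‖DQ (starMap B) z 0 * z‖ := (norm_mul _ _).symm
    _ = ‖starMap B z‖ := by rw [h]

omit hB hρ₀ hBρ in
/-- `E_B(z) ≠ 0` for `z ≠ 0` in the box. [folklore] -/
theorem starMap_ne_zero {z : ℂ} (hz : z ∈ jetBox R η) (hz0 : z ≠ 0) : starMap B z ≠ 0 :=
  hJ.map_ne_zero hz hz0

omit hB hρ₀ hBρ in
/-- The formula `d²/E − E'/z` is holomorphic at `z ≠ 0` in the box, with the quotient-rule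
derivative `−d²E'(z)/E(z)² − (E''(z) z − E'(z))/z²`. [folklore] -/
theorem hasDerivAt_driftFormula {z : ℂ} (hz : z ∈ jetBox R η) (hz0 : z ≠ 0) :
    HasDerivAt (fun w ↦ (starDeriv B : ℂ) ^ 2 / starMap B w - deriv (starMap B) w / w)
      (-((starDeriv B : ℂ) ^ 2 * deriv (starMap B) z / starMap B z ^ 2) -
        (deriv (deriv (starMap B)) z * z - deriv (starMap B) z * 1) / z ^ 2) z := by
  have hE : HasDerivAt (starMap B) (deriv (starMap B) z) z :=
    (hJ.differentiableOn.differentiableAt ((isOpen_jetBox R η).mem_nhds hz)).hasDerivAt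
  have hE' : HasDerivAt (deriv (starMap B)) (deriv (deriv (starMap B)) z) z :=
    (hJ.differentiableOn_deriv.differentiableAt ((isOpen_jetBox R η).mem_nhds hz)).hasDerivAt
  have h1 : HasDerivAt (fun w ↦ (starDeriv B : ℂ) ^ 2 / starMap B w)
      ((0 * starMap B z - (starDeriv B : ℂ) ^ 2 * deriv (starMap B) z) / starMap B z ^ 2) z :=
    (hasDerivAt_const z ((starDeriv B : ℂ) ^ 2)).div hE (starMap_ne_zero hJ hz hz0)
  have h2 : HasDerivAt (fun w ↦ deriv (starMap B) w / w)
      ((deriv (deriv (starMap B)) z * z - deriv (starMap B) z * 1) / z ^ 2) z := hE'.div (hasDerivAt_id z) hz0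
  exact (h1.sub h2).congr_deriv (by ring)

/-- **`glueDrift` is holomorphic on the box.** [cite: LawlerSchrammWerner2003Restriction, §5 (5.1)] -/
theorem differentiableOn_glueDrift : DifferentiableOn ℂ (glueDrift B ρ₀) (jetBox R η) := by
  intro z hz
  by_cases hsmall : ‖z‖ < ρ₀ / 4
  · -- near the tip: `glueDrift = starDrift` locally
    have hD : DifferentiableAt ℂ (starDrift B ρ₀) z :=
      (Loewner.differentiableOn_starDrift hB hρ₀ hBρ).differentiableAt
        (isOpen_ball.mem_nhds (mem_ball_zero_iff.2 (by linarith)))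
    exact (hD.congr_of_eventuallyEq (glueDrift_eventuallyEq_starDrift hsmall)).differentiableWithinAt
  · -- away from the tip: `glueDrift = formula` on the open set `jetBox ∖ {0}`
    have hz0 : z ≠ 0 := by intro h; rw [h, norm_zero] at hsmall; exact hsmall (by positivity)
    have hev : glueDrift B ρ₀ =ᶠ[𝓝 z] fun w ↦ (starDeriv B : ℂ) ^ 2 / starMap B w - deriv (starMap B) w / w := by
      filter_upwards [isOpen_ne.mem_nhds hz0] with w hw using glueDrift_eq_of_ne_zero hB hρ₀ hBρ hw
    exact ((hasDerivAt_driftFormula hJ hz hz0).differentiableAt.congr_of_eventuallyEq hev).differentiableWithinAt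

/-- The bound for `|glueDrift|` on the box. [folklore] -/
def glueDriftBound (ρ₀ δ : ℝ) : ℝ := 32 / ρ₀ + 4 / (δ * ρ₀)

omit hJ in
/-- Near the tip: `|glueDrift z| ≤ 24/ρ₀` for `|z| < ρ₀/4`. [folklore] -/
theorem norm_glueDrift_le_near {z : ℂ} (hz : ‖z‖ < ρ₀ / 4) : ‖glueDrift B ρ₀ z‖ ≤ 24 / ρ₀ := by
  rw [glueDrift_eq_starDrift hz, starDrift_eq hB]
  obtain ⟨h0, -, -⟩ := Loewner.norm_driftFun_le hB (isRestrictionMap_starRMap hB) (starDeriv_spec hB).2.2 hρ₀ hBρ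
  exact h0 z (mem_closedBall_zero_iff.2 hz.le)

/-- **`|glueDrift| ≤ glueDriftBound` on the box** (away from the tip `|d²/E| ≤ 4/(δρ₀)`,
`|E'/z| ≤ 8/ρ₀`). [folklore] -/
theorem norm_glueDrift_le {z : ℂ} (hz : z ∈ jetBox R η) : ‖glueDrift B ρ₀ z‖ ≤ glueDriftBound ρ₀ δ := by
  have hδ := hJ.δ_pos
  unfold glueDriftBound
  by_cases hsmall : ‖z‖ < ρ₀ / 4
  · have h1 := norm_glueDrift_le_near hB hρ₀ hBρ hsmall
    have h2 : 0 ≤ 4 / (δ * ρ₀) := by positivity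
    have h3 : 24 / ρ₀ ≤ 32 / ρ₀ := div_le_div_of_nonneg_right (by norm_num) hρ₀.le
    linarith
  · push Not at hsmall
    have hz0 : z ≠ 0 := by intro h; rw [h, norm_zero] at hsmall; linarith
    have hzpos : 0 < ‖z‖ := norm_pos_iff.2 hz0
    rw [glueDrift_eq_of_ne_zero hB hρ₀ hBρ hz0]
    obtain ⟨hd0, hd1, -⟩ := starDeriv_spec hB
    have hE := norm_starMap_ge hJ hz
    have hEpos : 0 < ‖starMap B z‖ := lt_of_lt_of_le (mul_pos hδ hzpos) hE
    have t1 : ‖(starDeriv B : ℂ) ^ 2 / starMap B z‖ ≤ 4 / (δ * ρ₀) := by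
      rw [norm_div, norm_pow, Complex.norm_real, Real.norm_of_nonneg hd0.le, div_le_div_iff₀ hEpos (by positivity)]
      have hsq : starDeriv B ^ 2 ≤ 1 := by nlinarith
      calc starDeriv B ^ 2 * (δ * ρ₀) ≤ 1 * (δ * ρ₀) := by gcongr
        _ = 4 * (δ * (ρ₀ / 4)) := by ring
        _ ≤ 4 * (δ * ‖z‖) := by gcongr
        _ ≤ 4 * ‖starMap B z‖ := by linarith
    have t2 : ‖deriv (starMap B) z / z‖ ≤ 8 / ρ₀ := by
      rw [norm_div, div_le_div_iff₀ hzpos hρ₀]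
      have := hJ.norm_deriv_le z hz
      nlinarith
    have h3 : 8 / ρ₀ ≤ 32 / ρ₀ := div_le_div_of_nonneg_right (by norm_num) hρ₀.le
    calc _ ≤ ‖(starDeriv B : ℂ) ^ 2 / starMap B z‖ + ‖deriv (starMap B) z / z‖ := norm_sub_le _ _
      _ ≤ 4 / (δ * ρ₀) + 8 / ρ₀ := add_le_add t1 t2
      _ ≤ 32 / ρ₀ + 4 / (δ * ρ₀) := by linarith

/-- **`glueDrift` is a `DriftData` for the box.** [cite: LawlerSchrammWerner2003Restriction, §5 (5.1)] -/
theorem driftData_glueDrift : DriftData (glueDrift B ρ₀) η R (glueDriftBound ρ₀ δ) :=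
  ⟨differentiableOn_glueDrift hB hρ₀ hBρ hJ, fun _ hz ↦ norm_glueDrift_le hB hρ₀ hBρ hJ hz,
    by unfold glueDriftBound; have := hJ.δ_pos; positivity⟩

/-- The value and derivative of `glueDrift` at `o ≠ 0` in the box (the formula and its quotient-rule
derivative). [folklore] -/
theorem glueDrift_and_deriv_of_ne_zero {o : ℂ} (ho : o ∈ jetBox R η) (ho0 : o ≠ 0) :
    glueDrift B ρ₀ o = (starDeriv B : ℂ) ^ 2 / starMap B o - deriv (starMap B) o / o ∧
      deriv (glueDrift B ρ₀) o = -((starDeriv B : ℂ) ^ 2 * deriv (starMap B) o / starMap B o ^ 2) -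
        deriv (deriv (starMap B)) o / o + deriv (starMap B) o / o ^ 2 := by
  refine ⟨glueDrift_eq_of_ne_zero hB hρ₀ hBρ ho0, ?_⟩
  have hev : glueDrift B ρ₀ =ᶠ[𝓝 o] fun w ↦ (starDeriv B : ℂ) ^ 2 / starMap B w - deriv (starMap B) w / w := by
    filter_upwards [isOpen_ne.mem_nhds ho0] with w hw using glueDrift_eq_of_ne_zero hB hρ₀ hBρ hw
  rw [hev.deriv_eq, (hasDerivAt_driftFormula hJ ho ho0).deriv]
  field_simp
  ring

/-- **`lam E_B (glueDrift) ρ 0 o = jetLam …`** at `o ≠ 0` in the box (with `d = starDeriv B = E_B'(0)`).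
[cite: LawlerSchrammWerner2003Restriction, proof of Lemma 8.9 (the dt-terms)] -/
theorem lam_glueDrift_zero_eq_jetLam (ρ : ℝ) {o : ℂ} (ho : o ∈ jetBox R η) (ho0 : o ≠ 0) :
    lam (starMap B) (glueDrift B ρ₀) ρ 0 o =
      jetLam (expB ρ : ℂ) (expC ρ : ℂ) o (starMap B o) (deriv (starMap B) o) (deriv (deriv (starMap B)) o)
        (deriv (starMap B) 0) (deriv (deriv (starMap B)) 0) (deriv (deriv (deriv (starMap B))) 0) := by
  obtain ⟨hDo, hD'o⟩ := glueDrift_and_deriv_of_ne_zero hB hρ₀ hBρ hJ ho ho0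
  have hd : (starDeriv B : ℂ) = deriv (starMap B) 0 := (deriv_starMap_zero hB).symm
  refine lam_zero_eq_jetLam hJ ρ ho ho0 (glueDrift_zero hB hρ₀ hBρ) ?_ ?_ ?_
  · rw [deriv_glueDrift_zero hB hρ₀ hBρ, hd]
  · rw [hDo, hd]
  · rw [hD'o, hd]

end Box

end SLEKappaRho

end Literature.Probability.RandomPlanarGeometry

end
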